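import Mathlib.MeasureTheory.Constructions.Pi
import Mathlib.Probability.Independence.Basic
import Mathlib.Probability.Independence.Integration
import HarnessLib

/-!
# Crux `NearConstantShortTimeHL` (stmt-AtomisticToContinuum-12502), line `small-tilt-domination` — stubs `lintegral_prod_eq_prod_of_dependsOn_disjoint`, `lintegral_pi_comp_equiv_finset`

Support file for the crux `…Theses.RelayRaceLocality.NearConstantShortTimeHL` (route
`route-AtomisticToContinuum-RelayRaceLocality`), line `small-tilt-domination`: two generic lemmas about a finite
product `Measure.pi μ` of probability measures on a common space `X`, used by the conditional Gaussian
chessboard estimate `stub_velocityLD` (there the velocities `v : Fin m → V3` are independent Gaussians,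
`velMeasure u θ x = Measure.pi fun i => gaussMeasure (u (x i)) (θ (x i))`).

* `lintegral_prod_eq_prod_of_dependsOn_disjoint`: if the functionals `F c` (`c ∈ C`) are measurable and each
  depends only on the coordinates in a block `I c`, the blocks being pairwise disjoint over `C`, then
  `∫⁻ ∏_{c ∈ C} F c = ∏_{c ∈ C} ∫⁻ F c`. Proof: the coordinate maps are independent under `Measure.pi`
  (`ProbabilityTheory.iIndepFun_pi`), tuples over disjoint index blocks of an independent family are independent
  (`iIndepFun.indepFun_finset`), a functional depending only on a block factors measurably through the block tuple
  (`Function.updateFinset`), so `E[g h] = E[g] E[h]` for two disjoint blocks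
  (`lintegral_mul_eq_mul_of_dependsOn_disjoint`); then induction on `C`.
* `lintegral_pi_comp_equiv_finset`: for a block `S` enumerated by `e : Fin k ≃ S`, a measurable functional of
  `(v (e a))_{a < k}` integrates against the `k`-fold product of the block marginals. Proof: `Measure.pi μ` pushes
  forward under `S.restrict` to `Measure.pi (fun i : S => μ i)` (`measurePreserving_finsetRestrict_pi`, checked on
  boxes with `Measure.pi_eq`), and reindexing along `e` is `measurePreserving_piCongrLeft`.

All statements are folklore product-measure facts; nothing here is specific to the hard-sphere gas.
-/

noncomputable section

namespace Summit.AtomisticToContinuum.HydrodynamicLimit.Theorems.NearConstantShortTimeHL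

open MeasureTheory ProbabilityTheory
open scoped ENNReal

/-! ## Two disjoint blocks -/

/-- Two-block factorisation under a finite product of probability measures: if `g` is measurable and depends
only on the coordinates in `S`, `h` is measurable and depends only on the coordinates in `T`, and `S`, `T` are
disjoint, then `∫⁻ g * h = (∫⁻ g) * (∫⁻ h)` for `Measure.pi μ`. The coordinates are independent
(`iIndepFun_pi`), hence so are the `S`- and `T`-tuples (`iIndepFun.indepFun_finset`) and the functionals
factoring through them. [folklore] -/
theorem lintegral_mul_eq_mul_of_dependsOn_disjoint {δ X : Type*} [Fintype δ] [DecidableEq δ]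
    [MeasurableSpace X] (μ : δ → Measure X) [∀ i, IsProbabilityMeasure (μ i)]
    (S T : Finset δ) (hST : Disjoint S T) (g h : (δ → X) → ℝ≥0∞) (hg : Measurable g)
    (hh : Measurable h) (hgS : ∀ v w : δ → X, (∀ i ∈ S, v i = w i) → g v = g w)
    (hhT : ∀ v w : δ → X, (∀ i ∈ T, v i = w i) → h v = h w) :
    ∫⁻ v, g v * h v ∂Measure.pi μ = (∫⁻ v, g v ∂Measure.pi μ) * ∫⁻ v, h v ∂Measure.pi μ := by
  obtain ⟨x⟩ : Nonempty (δ → X) := nonempty_of_isProbabilityMeasure (Measure.pi μ)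
  have hind : iIndepFun (fun i (v : δ → X) => v i) (Measure.pi μ) :=
    iIndepFun_pi (μ := μ) (X := fun _ y => y) fun _ => aemeasurable_id'
  have hST' : IndepFun (fun v (i : S) => v (i : δ)) (fun v (i : T) => v (i : δ)) (Measure.pi μ) :=
    hind.indepFun_finset S T hST fun i => measurable_pi_apply i
  have hg' : g = (fun w => g (Function.updateFinset x S w)) ∘ fun v (i : S) => v (i : δ) := by
    funext v
    refine hgS v _ fun i hi => ?_
    simp [Function.updateFinset, hi]
  have hh' : h = (fun w => h (Function.updateFinset x T w)) ∘ fun v (i : T) => v (i : δ) := by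
    funext v
    refine hhT v _ fun i hi => ?_
    simp [Function.updateFinset, hi]
  have hind2 : IndepFun g h (Measure.pi μ) := by
    rw [hg', hh']
    exact hST'.comp (hg.comp measurable_updateFinset) (hh.comp measurable_updateFinset)
  exact lintegral_mul_eq_lintegral_mul_lintegral_of_indepFun'' hg.aemeasurable hh.aemeasurable hind2

/-! ## Finitely many pairwise disjoint blocks -/

/-- Product factorisation under a finite product of probability measures: if the functionals `F c`, `c ∈ C`,
are measurable and `F c` depends only on the coordinates in the block `I c`, the blocks being pairwise disjoint
over `C`, then `∫⁻ v, ∏_{c ∈ C} F c v ∂(Measure.pi μ) = ∏_{c ∈ C} ∫⁻ v, F c v ∂(Measure.pi μ)`. Induction on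
`C`, splitting off one block against the union of the others with `lintegral_mul_eq_mul_of_dependsOn_disjoint`.
[folklore] -/
theorem lintegral_prod_eq_prod_of_dependsOn_disjoint : ∀ {δ X : Type*} [Fintype δ] [DecidableEq δ] [MeasurableSpace X] (μ : δ → Measure X) [∀ i, IsProbabilityMeasure (μ i)] {ι : Type*} (C : Finset ι) (I : ι → Finset δ), (∀ a ∈ C, ∀ b ∈ C, a ≠ b → Disjoint (I a) (I b)) → ∀ F : ι → (δ → X) → ℝ≥0∞, (∀ c ∈ C, Measurable (F c)) → (∀ c ∈ C, ∀ v w : δ → X, (∀ i ∈ I c, v i = w i) → F c v = F c w) → ∫⁻ v, ∏ c ∈ C, F c v ∂Measure.pi μ = ∏ c ∈ C, ∫⁻ v, F c v ∂Measure.pi μ := by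
  intro δ X _ _ _ μ _ ι C I hdisj F hFm hFdep
  classical
  induction C using Finset.induction_on with
  | empty => simp
  | insert c₀ C' hc₀ ih =>
    have hdisj' : ∀ a ∈ C', ∀ b ∈ C', a ≠ b → Disjoint (I a) (I b) :=
      fun a ha b hb => hdisj a (Finset.mem_insert_of_mem ha) b (Finset.mem_insert_of_mem hb)
    have hFm' : ∀ c ∈ C', Measurable (F c) := fun c hc => hFm c (Finset.mem_insert_of_mem hc)
    have hFdep' : ∀ c ∈ C', ∀ v w : δ → X, (∀ i ∈ I c, v i = w i) → F c v = F c w :=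
      fun c hc => hFdep c (Finset.mem_insert_of_mem hc)
    simp only [Finset.prod_insert hc₀]
    rw [← ih hdisj' hFm' hFdep']
    refine lintegral_mul_eq_mul_of_dependsOn_disjoint μ (I c₀) (C'.biUnion I) ?_ (F c₀)
      (fun v => ∏ c ∈ C', F c v) (hFm c₀ (Finset.mem_insert_self _ _))
      (Finset.measurable_prod _ fun c hc => hFm' c hc) (hFdep c₀ (Finset.mem_insert_self _ _)) ?_
    · rw [Finset.disjoint_biUnion_right]
      intro c hc
      refine hdisj c₀ (Finset.mem_insert_self _ _) c (Finset.mem_insert_of_mem hc) fun h0 => hc₀ ?_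
      rw [h0]
      exact hc
    · intro v w hvw
      exact Finset.prod_congr rfl fun c hc =>
        hFdep' c hc v w fun i hi => hvw i (Finset.mem_biUnion.mpr ⟨c, hc, hi⟩)

/-! ## Restriction to a block and reindexing -/

/-- Restriction of a finite product of probability measures to a block of coordinates: the push-forward of
`Measure.pi μ` under `S.restrict : (δ → X) → (S → X)` is the product `Measure.pi (fun i : S => μ i)` of the
block's marginals (checked on measurable boxes, whose preimages are cylinders of full measure off `S`).
[folklore] -/
theorem measurePreserving_finsetRestrict_pi {δ X : Type*} [Fintype δ] [DecidableEq δ] [MeasurableSpace X]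
    (μ : δ → Measure X) [∀ i, IsProbabilityMeasure (μ i)] (S : Finset δ) :
    MeasurePreserving (S.restrict (π := fun _ : δ => X)) (Measure.pi μ) (Measure.pi fun i : S => μ i) := by
  refine ⟨Finset.measurable_restrict S, (Measure.pi_eq fun s hs => ?_).symm⟩
  rw [Measure.map_apply (Finset.measurable_restrict S) (MeasurableSet.univ_pi hs)]
  have hpre : S.restrict (π := fun _ : δ => X) ⁻¹' (Set.univ.pi s) =
      Set.univ.pi (fun i : δ => if hi : i ∈ S then s ⟨i, hi⟩ else Set.univ) := by
    ext v
    simp only [Set.mem_preimage, Set.mem_univ_pi, Finset.restrict]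
    constructor
    · intro hv i
      by_cases hi : i ∈ S
      · rw [dif_pos hi]
        exact hv ⟨i, hi⟩
      · rw [dif_neg hi]
        exact Set.mem_univ _
    · intro hv i
      have h1 := hv i
      rw [dif_pos i.2] at h1
      exact h1
  rw [hpre, Measure.pi_pi, ← Finset.prod_mul_prod_compl S]
  have h1 : ∏ i ∈ Sᶜ, μ i (if hi : i ∈ S then s ⟨i, hi⟩ else Set.univ) = 1 :=
    Finset.prod_eq_one fun i hi => by rw [dif_neg (Finset.mem_compl.mp hi), measure_univ]
  rw [h1, mul_one, ← Finset.prod_coe_sort S]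
  refine Finset.prod_congr rfl fun i _ => ?_
  rw [dif_pos i.2]

/-- Change of variables to a block: for `e : Fin k ≃ S` an enumeration of a block `S` of coordinates and a
measurable `Φ : (Fin k → X) → ℝ≥0∞`, `∫⁻ v, Φ (a ↦ v (e a)) ∂(Measure.pi μ) = ∫⁻ w, Φ w ∂(Measure.pi (a ↦ μ (e a)))`
(restriction to the block, `measurePreserving_finsetRestrict_pi`, followed by the reindexing
`measurePreserving_piCongrLeft` along `e`). [folklore] -/
theorem lintegral_pi_comp_equiv_finset : ∀ {δ X : Type*} [Fintype δ] [DecidableEq δ] [MeasurableSpace X] (μ : δ → Measure X) [∀ i, IsProbabilityMeasure (μ i)] (S : Finset δ) {k : ℕ} (e : Fin k ≃ ↥S) (Φ : (Fin k → X) → ℝ≥0∞), Measurable Φ → ∫⁻ v, Φ (fun a => v (e a)) ∂Measure.pi μ = ∫⁻ w, Φ w ∂Measure.pi (fun a => μ (e a)) := by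
  intro δ X _ _ _ μ _ S k e Φ hΦ
  have h1 := measurePreserving_finsetRestrict_pi μ S
  have h2 : MeasurePreserving (MeasurableEquiv.piCongrLeft (fun _ : S => X) e).symm
      (Measure.pi fun i : S => μ i) (Measure.pi fun a => μ (e a)) :=
    (measurePreserving_piCongrLeft (fun i : S => μ i) e).symm _
  have h3 := (h2.comp h1).lintegral_comp hΦ
  exact h3

end Summit.AtomisticToContinuum.HydrodynamicLimit.Theorems.NearConstantShortTimeHL
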